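import Literature.NumberTheory.GaloisRepresentations.LubinTateColemanUnitsImageTraceNormTwo
import HarnessLib

/-!
# `N_Σ(E) ≤ N(E')`: the `ℤ/d`-trace of the image of the two-variable Coleman map along `E` (`[E_m : F] = d·p^m`) lies in the image of the
# Coleman map of the `ℤ_p`-subtower `E'` (`[E'_m : F] = p^m`) — admissibility passes to the trace (de Shalit I §3.8 (16)–(17))

De Shalit, *Iwasawa theory of elliptic curves with complex multiplication* (1987), Ch. I §3.8 (16)–(17), Ch. III §1.3: the measure `i(β)` on
`𝒢 = ℤ/d × ℤ_p × 𝒪^×` pushes forward to the measure of the norm `N_{ℤ/d} β` on the quotient `ℤ_p × 𝒪^×`.  In the tree: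
`indexTraceₗ_colemanImage_eq_colemanImage_subtower` (`Σ_j Col_E(β)(j) = Col_{E'}(N β)`, `LubinTateColemanUnitsImageTraceNormTwo`) and the
submodules `unitsImage` (membership = levelwise ADMISSIBILITY of the constant terms: the level partner lies in `(1 − uφ)𝒪_{E_m}`,
`LubinTateColemanUnitsImageModuleTwo`) and `unitsImageTrace = Σ(unitsImage)` (`LubinTateColemanUnitsImageTraceTwo`).  THIS file proves
the inclusion of submodules (everything PROVED, 0 sorry, no definitions):

* `unitBallTrace_mem_anomalyRange` — `Tr_{E_m/E'_m}((1 − uφ)𝒪_{E_m}) ⊆ (1 − uφ')𝒪_{E'_m}` (`Tr ∘ φ = φ' ∘ Tr`);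
* ★ `IsAdmissibleLevel.indexTrace` — admissibility passes to `(Σ_j x j, Tr y)` along the sub-tower (`IsAmiceLevel.indexTrace` + the above);
* `constTerm_const_indexTraceₗ` — the constant terms of `Σ_j G_j` are `Σ_j` of the constant terms;
* ★★ `const_indexTraceₗ_mem_unitsImage_subtower` — **`G ∈ N(E) ⟹ Σ_j G_j ∈ N(E')`** (as a `ℤ/1`-indexed family);
* ★★★ **`unitsImageTrace_le_unitsImageTrace_subtower`** — `N_Σ(E) ≤ N_Σ(E') (= N(E')`, `d = 1`) as `Λ`-submodules of `M₁`.

Use (sequel, Summits side): the (c)-identity `char_Λ((N/Col 𝒞̄)_ε) = (L_ε)` holds with the SAME right-hand side for `N = N_Σ(E)` and for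
`N = N(E')` ⊇ `N_Σ(E)` (both have pseudo-null cokernel in `M₁`), which is the form the `d = 1` (Rubin `K̃_∞`) dictionary consumes.

## References
* E. de Shalit, *Iwasawa theory of elliptic curves with complex multiplication* (1987), Ch. I §3.7, §3.8 (16)–(17); Ch. III §1.3. [deShalit1987]
-/

noncomputable section

namespace Literature.NumberTheory.GaloisRepresentations

section UnitsImageTraceSubtowerTwo

open GaloisRepresentations.IsNonarchimedeanLocalField LubinTate ValuativeRel Field Finset

variable {F : Type} [Field F] [ValuativeRel F] [TopologicalSpace F] [IsNonarchimedeanLocalField F]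

attribute [local instance] ltNormUniformSpace ltNormIsUniformAddGroup rk1 nF nE fintypeResidueField

variable {p : ℕ} [hp : Fact p.Prime] {d : ℕ} [NeZero d] (hd : d.Coprime p)
variable {π : 𝒪[F]} (hπ : (valuation F).IsUniformizer (π : F))
variable (E E' : ℕ → IntermediateField F (AlgebraicClosure F)) [∀ m, FiniteDimensional F (E m)] [∀ m, Normal F (E m)] [∀ m, IsGalois F (E m)]
  [∀ m, FiniteDimensional F (E' m)] [∀ m, Normal F (E' m)] [∀ m, IsGalois F (E' m)]
  (hmono : Monotone E) (hmono' : Monotone E') (h : ∀ m, E' m ≤ E m)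
  (hE : ∀ m, E m ≤ maxUnramified F) (hE' : ∀ m, E' m ≤ maxUnramified F)
  (hdeg : ∀ m, Module.finrank F (E m) = d * p ^ m) (hdeg' : ∀ m, Module.finrank F (E' m) = 1 * p ^ m)
  {σ₀ : absoluteGaloisGroup F} (hσ₀ : IsAbsArithFrob σ₀) (hq : residueFieldCard F = 2)
variable (u : (LTCoeff F)ˣ) (hu : LTCoeff.of F π = residueFieldCard F * u) (γ : 𝒪[F]ˣ)

/-! ### Admissibility passes to the trace -/

omit hp [NeZero d] in
/-- **`Tr((1 − uφ)𝒪_{E₂}) ⊆ (1 − uφ)𝒪_{E₁}`** for `E₁ ≤ E₂` (`Tr ∘ φ_{E₂} = φ_{E₁} ∘ Tr`, `Tr` is `𝒪_F`-linear). [cite: deShalit1987, Ch. I §3.7, §3.8 (16)] -/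
theorem unitBallTrace_mem_anomalyRange {E₁ E₂ : IntermediateField F (AlgebraicClosure F)} [FiniteDimensional F E₁] [FiniteDimensional F E₂]
    [Normal F E₁] [Normal F E₂] [IsGalois F E₂] (h12 : E₁ ≤ E₂) (u' : 𝒪[F]) {c : unitBall E₂} (hc : c ∈ anomalyRange σ₀ E₂ u') :
    unitBallTrace h12 c ∈ anomalyRange σ₀ E₁ u' := by
  obtain ⟨z, rfl⟩ := hc
  refine ⟨unitBallTrace h12 z, ?_⟩
  rw [map_sub, ← unitBallTrace_frobUnitBall, ← Algebra.smul_def, LinearMap.map_smul, Algebra.smul_def]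

include hE hE' hdeg hdeg' hσ₀ in
/-- ★ **Admissibility passes to the trace**: if `x : ℤ/d → 𝒪_F⟦X⟧` is admissible at level `m` for `E` then `(_ ↦ Σ_j x j)` is admissible at
level `m` for the sub-tower `E'` (generators `Tr θ_m`). [cite: deShalit1987, Ch. I §3.8 (16)–(17)] -/
theorem IsAdmissibleLevel.indexTrace {m : ℕ} {θ : unitBall (E m)} {hθ : IsIntegralNormalGen (E m) θ} {u' : 𝒪[F]}
    {x : ZMod d → PowerSeries 𝒪[F]} (hx : IsAdmissibleLevel p d hd σ₀ hθ u' x) :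
    IsAdmissibleLevel p 1 (Nat.coprime_one_left p) σ₀ (E := E') (hθ.unitBallTrace (h m)) u' (fun _ => ∑ j : ZMod d, x j) := by
  obtain ⟨y, hy, hyR⟩ := hx
  exact ⟨unitBallTrace (h m) y, hy.indexTrace hd E E' h hE hE' hdeg hdeg' hσ₀, unitBallTrace_mem_anomalyRange (h m) u' hyR⟩

variable [IsAdicComplete (Ideal.span {intBase F (LTCoeff.of F π)}) (PowerSeries 𝒪[F])]

omit hp in
/-- The constant terms of the constant family `(_ ↦ Σ_j G_j)` are `Σ_j` of the constant terms of `G`. [cite: deShalit1987, Ch. I §3.8 (17)] -/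
theorem constTerm_const_indexTraceₗ (G : ZMod d → ColemanCoordModule hπ hq (intBase F) u hu γ) :
    constTerm hπ hq u hu γ (fun _ : ZMod 1 => indexTraceₗ hπ hq u hu γ G) = fun _ => ∑ j : ZMod d, constTerm hπ hq u hu γ G j := by
  funext j'
  rw [constTerm_apply, indexTraceₗ_apply, map_sum, map_sum]
  rfl

variable [CharZero F] [IsAdicComplete (Ideal.span {(p : 𝒪[F])}) 𝒪[F]] (hI : Ideal.span {(p : 𝒪[F])} ≠ ⊤)
variable {θ : ∀ m, unitBall (E m)} (hθ : ∀ m, IsIntegralNormalGen (E m) (θ m))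
  (hcoh : ∀ m, unitBallTrace (hmono (Nat.le_succ m)) (θ (m + 1)) = θ m)
  (hud : ∀ m, (u : LTCoeff F) ^ Module.finrank F (E m) ≠ 1) (hud' : ∀ m, (u : LTCoeff F) ^ Module.finrank F (E' m) ≠ 1)

include hE hdeg hdeg' in
/-- ★★ **`G ∈ N(E) ⟹ (_ ↦ Σ_j G_j) ∈ N(E')`** — membership in the image submodule is levelwise admissibility, which passes to the trace.
[cite: deShalit1987, Ch. I §3.8 (16)–(17); Ch. III §1.3] -/
theorem const_indexTraceₗ_mem_unitsImage_subtower {G : ZMod d → ColemanCoordModule hπ hq (intBase F) u hu γ}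
    (hG : G ∈ unitsImage hd hπ E hmono hE hdeg hσ₀ hq u hu γ hθ hcoh hI hud) :
    (fun _ : ZMod 1 => indexTraceₗ hπ hq u hu γ G) ∈
      unitsImage (Nat.coprime_one_left p) hπ E' hmono' hE' hdeg' hσ₀ hq u hu γ (isIntegralNormalGen_subtower E E' h hθ)
        (coherent_subtower E E' hmono hmono' h hcoh) hI hud' := by
  rw [mem_unitsImage_iff] at hG ⊢
  intro m
  rw [constTerm_const_indexTraceₗ]
  exact (hG m).indexTrace hd E E' h hE hE' hdeg hdeg' hσ₀

include hE hdeg hdeg' in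
/-- ★★★ **`N_Σ(E) ≤ N_Σ(E')`**: the `ℤ/d`-trace of the image of the two-variable Coleman map along `E` lies in the image along the
`ℤ_p`-subtower `E'` (`d = 1`, where `N_Σ = N`).  [cite: deShalit1987, Ch. I §3.8 (16)–(17); Ch. III §1.3] -/
theorem unitsImageTrace_le_unitsImageTrace_subtower :
    unitsImageTrace hd hπ E hmono hE hdeg hσ₀ hq u hu γ hθ hcoh hI hud ≤
      unitsImageTrace (Nat.coprime_one_left p) hπ E' hmono' hE' hdeg' hσ₀ hq u hu γ (isIntegralNormalGen_subtower E E' h hθ)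
        (coherent_subtower E E' hmono hmono' h hcoh) hI hud' := by
  intro x hx
  obtain ⟨G, hG, rfl⟩ := (mem_unitsImageTrace_iff hd hπ E hmono hE hdeg hσ₀ hq u hu γ hθ hcoh hI hud x).mp hx
  refine (mem_unitsImageTrace_iff (Nat.coprime_one_left p) hπ E' hmono' hE' hdeg' hσ₀ hq u hu γ _ _ hI hud' _).mpr
    ⟨fun _ : ZMod 1 => indexTraceₗ hπ hq u hu γ G,
      const_indexTraceₗ_mem_unitsImage_subtower hd hπ E E' hmono hmono' h hE hE' hdeg hdeg' hσ₀ hq u hu γ hI hθ hcoh hud hud' hG, ?_⟩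
  rw [indexTraceₗ_apply, Fintype.sum_unique]

end UnitsImageTraceSubtowerTwo

end Literature.NumberTheory.GaloisRepresentations
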